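import Summits.QuantumFields.YangMills.Theorems.UnitScaleTiltProp7AccretiveConjOperatorBound
import HarnessLib

/-!
# Route `UnitScaleTilt`, crux K1 «MinimiserStabilityRegPr» (stmt-QuantumFields-19200), EX rows `h349` ∕ `hGF` (curved member) — **LOD LINE ENGINE for (L5) (★p1 g24): THE DIFFERENCE OF TWO
# MASSIVE PROPAGATORS UNDER A FIRST-ORDER (ENERGY-RELATIVELY BOUNDED) PERTURBATION IS OPERATOR-SMALL** — `A⁻¹ − B⁻¹ = A⁻¹(B − A)B⁻¹` with `‖(B − A)w‖ ≤ c₁‖Dw‖ + c₀‖w‖` and the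
# energy identity `‖Dw‖² ≤ Re⟨w, Bw⟩` gives `‖(A⁻¹ − B⁻¹)f‖ ≤ m_A⁻¹·(c₁·m_B^{−1∕2} + c₀·m_B⁻¹)·‖f‖` — the inverse SMOOTHS one derivative, so a perturbation that is NOT operator-small
# (the local-gauge comparison `Δ_{U^g} − Δ_1 ≈ 2A·∇^η`, `A = O(ε₀R)`, CARD-19200-V3-g24 §5) still moves `G_a`, hence `B = G_aQ″†`, `M`, `P`, by `O(ε₀R)` in operator norm.

Cell `ym3-torus` (HUMAN RULING D-0037, YM ladder rung R3 — NOT d = 4, NOT a mass gap, NOT Clay).  Fleet lead seat `ym-ust-19200-p1` gen 24.  THEOREMS ONLY (0 `def`, 0 `sorry`), Mathlib +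
this seat's ✓p747790; `--supports stmt-QuantumFields-19200 --as helper`, count-neutral.  HONEST LABEL (№33 (6)): curved γ-row supplier line (LOD localisation); ENGINE for the unassigned
(L5) local-gauge brick; nothing of (3.49), Thm 3.1∕3.3, `h349`, `hGF`, EX ∕ 19200 is proved.

WHAT IS PROVED (ns `Summit.QuantumFields.YangMills.Theorems.Prop7InverseDiffFirstOrder`; `A B : Matrix n n ℂ`, `Dm : Matrix k n ℂ` the «derivative», all norms as `ℓ²` sums).
* §1 `sum_normSq_D_inv_le` — energy bound of the inverse: `‖Dw‖² ≤ Re⟨w,Bw⟩`, `B` `m`-accretive ⟹ `Σ‖(D B⁻¹ f)‖² ≤ m⁻¹·Σ‖f‖²` (`w = B⁻¹f`: `‖Dw‖² ≤ Re⟨w,f⟩ ≤ ‖w‖‖f‖ ≤ ‖f‖²∕m`).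
* §2 ★★★ `norm_inv_sub_inv_mulVec_le` — `A` `m_A`-accretive, `B` `m_B`-accretive with the energy identity for `Dm`, `E := B − A` with `‖Ew‖ ≤ c₁‖Dm w‖ + c₀‖w‖` ⟹
  `‖(A⁻¹ − B⁻¹)f‖₂ ≤ m_A⁻¹·(c₁·(√m_B)⁻¹ + c₀·m_B⁻¹)·‖f‖₂`.

References: T. Kato, *Perturbation theory for linear operators* (1966) VI §3 (second resolvent identity); T. Bałaban, CMP **99** (1985) 389–434 [Balaban1985BackgroundPropagators]
((3.26)–(3.27) p.395, Thm 3.3 p.399).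
-/

set_option autoImplicit false

noncomputable section

open scoped Matrix ComplexConjugate BigOperators
open Finset

namespace Summit.QuantumFields.YangMills.Theorems.Prop7InverseDiffFirstOrder

open Literature.MathematicalPhysics.QuantumFieldTheory.Balaban1983to89.B13Sqrt27Accretive (resolvent_bound_of_accretive)
open Summit.QuantumFields.YangMills.Theorems.Prop7AccretiveConjOperatorBound (re_sum_star_mul_le sum_normSq_le_of_accretive_pairing sum_normSq_inv_mulVec_le_of_accretive)

variable {n k : Type*} [Fintype n] [Fintype k] [DecidableEq n]

/-! ## §1 The energy bound of the inverse -/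

/-- ★ **ENERGY BOUND OF THE INVERSE**: if `Σ‖(Dm w)_j‖² ≤ Re Σ w̄_i(Bw)_i` for all `w` and `B` is `m`-accretive (`m > 0`), then for `w = B⁻¹f`:
`Σ‖(Dm (B⁻¹f))_j‖² ≤ m⁻¹·Σ‖f_i‖²`. [cite: Balaban1985BackgroundPropagators, Thm 3.3 p.399] -/
theorem sum_normSq_D_inv_le (B : Matrix n n ℂ) (Dm : Matrix k n ℂ) {m : ℝ} (hm : 0 < m)
    (hacc : ∀ v : n → ℂ, m * ∑ i, ‖v i‖ ^ 2 ≤ (∑ i, star (v i) * (B *ᵥ v) i).re)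
    (henergy : ∀ w : n → ℂ, ∑ j, ‖(Dm *ᵥ w) j‖ ^ 2 ≤ (∑ i, star (w i) * (B *ᵥ w) i).re) (f : n → ℂ) :
    ∑ j, ‖(Dm *ᵥ (B⁻¹ *ᵥ f)) j‖ ^ 2 ≤ m⁻¹ * ∑ i, ‖f i‖ ^ 2 := by
  obtain ⟨hunit, hinv⟩ := sum_normSq_inv_mulVec_le_of_accretive B hm hacc f
  set w := B⁻¹ *ᵥ f with hw
  have hBw : B *ᵥ w = f := by rw [hw, Matrix.mulVec_mulVec, Matrix.mul_nonsing_inv B hunit, Matrix.one_mulVec]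
  have h1 : ∑ j, ‖(Dm *ᵥ w) j‖ ^ 2 ≤ (∑ i, star (w i) * f i).re := by
    have := henergy w; rwa [hBw] at this
  have hW : 0 ≤ ∑ i, ‖w i‖ ^ 2 := Finset.sum_nonneg fun i _ => by positivity
  have hF : 0 ≤ ∑ i, ‖f i‖ ^ 2 := Finset.sum_nonneg fun i _ => by positivity
  have h2 : (∑ i, star (w i) * f i).re ≤ Real.sqrt (∑ i, ‖w i‖ ^ 2) * Real.sqrt (∑ i, ‖f i‖ ^ 2) := re_sum_star_mul_le w f
  -- `√W ≤ √F / m` from `hinv : W ≤ m⁻² F`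
  have h3 : Real.sqrt (∑ i, ‖w i‖ ^ 2) ≤ m⁻¹ * Real.sqrt (∑ i, ‖f i‖ ^ 2) := by
    have := Real.sqrt_le_sqrt hinv
    rwa [Real.sqrt_mul (by positivity), Real.sqrt_sq (by positivity)] at this
  have hsqF : Real.sqrt (∑ i, ‖f i‖ ^ 2) * Real.sqrt (∑ i, ‖f i‖ ^ 2) = ∑ i, ‖f i‖ ^ 2 := Real.mul_self_sqrt hF
  calc ∑ j, ‖(Dm *ᵥ w) j‖ ^ 2 ≤ Real.sqrt (∑ i, ‖w i‖ ^ 2) * Real.sqrt (∑ i, ‖f i‖ ^ 2) := h1.trans h2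
    _ ≤ m⁻¹ * Real.sqrt (∑ i, ‖f i‖ ^ 2) * Real.sqrt (∑ i, ‖f i‖ ^ 2) := mul_le_mul_of_nonneg_right h3 (Real.sqrt_nonneg _)
    _ = m⁻¹ * ∑ i, ‖f i‖ ^ 2 := by rw [mul_assoc, hsqF]

/-! ## §2 The difference of the inverses -/

/-- The second resolvent identity for matrices: `A⁻¹ − B⁻¹ = A⁻¹ (B − A) B⁻¹`. [cite: Balaban1985BackgroundPropagators, (3.105) p.414] -/
theorem inv_sub_inv_eq (A B : Matrix n n ℂ) (hA : IsUnit A.det) (hB : IsUnit B.det) : A⁻¹ - B⁻¹ = A⁻¹ * (B - A) * B⁻¹ := by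
  rw [Matrix.mul_sub, Matrix.sub_mul, Matrix.mul_assoc, Matrix.mul_nonsing_inv B hB, Matrix.mul_one, Matrix.nonsing_inv_mul A hA, Matrix.one_mul]

/-- ★★★ **OPERATOR-SMALL DIFFERENCE OF INVERSES UNDER A FIRST-ORDER PERTURBATION**: `A` `m_A`-accretive, `B` `m_B`-accretive with the energy identity `Σ‖(Dm w)‖² ≤ Re⟨w,Bw⟩`,
and `‖(B − A)w‖₂ ≤ c₁‖Dm w‖₂ + c₀‖w‖₂` ⟹ `‖(A⁻¹ − B⁻¹)f‖₂ ≤ m_A⁻¹·(c₁·√(m_B⁻¹) + c₀·m_B⁻¹)·‖f‖₂` (all norms `= √Σ‖·‖²`).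
[cite: Balaban1985BackgroundPropagators, Thm 3.3 p.399, (3.105) p.414] -/
theorem norm_inv_sub_inv_mulVec_le (A B : Matrix n n ℂ) (Dm : Matrix k n ℂ) {mA mB c₁ c₀ : ℝ} (hmA : 0 < mA) (hmB : 0 < mB) (hc₁ : 0 ≤ c₁) (hc₀ : 0 ≤ c₀)
    (haccA : ∀ v : n → ℂ, mA * ∑ i, ‖v i‖ ^ 2 ≤ (∑ i, star (v i) * (A *ᵥ v) i).re)
    (haccB : ∀ v : n → ℂ, mB * ∑ i, ‖v i‖ ^ 2 ≤ (∑ i, star (v i) * (B *ᵥ v) i).re)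
    (henergy : ∀ w : n → ℂ, ∑ j, ‖(Dm *ᵥ w) j‖ ^ 2 ≤ (∑ i, star (w i) * (B *ᵥ w) i).re)
    (hE : ∀ w : n → ℂ, Real.sqrt (∑ i, ‖((B - A) *ᵥ w) i‖ ^ 2) ≤ c₁ * Real.sqrt (∑ j, ‖(Dm *ᵥ w) j‖ ^ 2) + c₀ * Real.sqrt (∑ i, ‖w i‖ ^ 2))
    (f : n → ℂ) :
    Real.sqrt (∑ i, ‖((A⁻¹ - B⁻¹) *ᵥ f) i‖ ^ 2) ≤ mA⁻¹ * (c₁ * Real.sqrt mB⁻¹ + c₀ * mB⁻¹) * Real.sqrt (∑ i, ‖f i‖ ^ 2) := by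
  have hA : IsUnit A.det := (sum_normSq_inv_mulVec_le_of_accretive A hmA haccA f).1
  obtain ⟨hB, hBinv⟩ := sum_normSq_inv_mulVec_le_of_accretive B hmB haccB f
  set w := B⁻¹ *ᵥ f with hw
  -- `(A⁻¹ − B⁻¹) f = A⁻¹ ((B − A) w)`
  have hid : (A⁻¹ - B⁻¹) *ᵥ f = A⁻¹ *ᵥ ((B - A) *ᵥ w) := by
    rw [inv_sub_inv_eq A B hA hB, hw, Matrix.mulVec_mulVec, Matrix.mulVec_mulVec]
  rw [hid]
  -- `‖A⁻¹ g‖ ≤ mA⁻¹ ‖g‖`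
  have h1 : Real.sqrt (∑ i, ‖(A⁻¹ *ᵥ ((B - A) *ᵥ w)) i‖ ^ 2) ≤ mA⁻¹ * Real.sqrt (∑ i, ‖((B - A) *ᵥ w) i‖ ^ 2) := by
    have := Real.sqrt_le_sqrt (sum_normSq_inv_mulVec_le_of_accretive A hmA haccA ((B - A) *ᵥ w)).2
    rwa [Real.sqrt_mul (by positivity), Real.sqrt_sq (by positivity)] at this
  -- `‖(B − A) w‖ ≤ c₁ ‖D w‖ + c₀ ‖w‖ ≤ (c₁ √(mB⁻¹) + c₀ mB⁻¹) ‖f‖`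
  have hD : Real.sqrt (∑ j, ‖(Dm *ᵥ w) j‖ ^ 2) ≤ Real.sqrt mB⁻¹ * Real.sqrt (∑ i, ‖f i‖ ^ 2) := by
    have := Real.sqrt_le_sqrt (sum_normSq_D_inv_le B Dm hmB haccB henergy f)
    rwa [Real.sqrt_mul (by positivity)] at this
  have hwn : Real.sqrt (∑ i, ‖w i‖ ^ 2) ≤ mB⁻¹ * Real.sqrt (∑ i, ‖f i‖ ^ 2) := by
    have := Real.sqrt_le_sqrt hBinv
    rwa [Real.sqrt_mul (by positivity), Real.sqrt_sq (by positivity)] at this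
  have h2 : Real.sqrt (∑ i, ‖((B - A) *ᵥ w) i‖ ^ 2) ≤ (c₁ * Real.sqrt mB⁻¹ + c₀ * mB⁻¹) * Real.sqrt (∑ i, ‖f i‖ ^ 2) := by
    calc Real.sqrt (∑ i, ‖((B - A) *ᵥ w) i‖ ^ 2) ≤ c₁ * Real.sqrt (∑ j, ‖(Dm *ᵥ w) j‖ ^ 2) + c₀ * Real.sqrt (∑ i, ‖w i‖ ^ 2) := hE w
      _ ≤ c₁ * (Real.sqrt mB⁻¹ * Real.sqrt (∑ i, ‖f i‖ ^ 2)) + c₀ * (mB⁻¹ * Real.sqrt (∑ i, ‖f i‖ ^ 2)) := by gcongr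
      _ = (c₁ * Real.sqrt mB⁻¹ + c₀ * mB⁻¹) * Real.sqrt (∑ i, ‖f i‖ ^ 2) := by ring
  calc Real.sqrt (∑ i, ‖(A⁻¹ *ᵥ ((B - A) *ᵥ w)) i‖ ^ 2) ≤ mA⁻¹ * Real.sqrt (∑ i, ‖((B - A) *ᵥ w) i‖ ^ 2) := h1
    _ ≤ mA⁻¹ * ((c₁ * Real.sqrt mB⁻¹ + c₀ * mB⁻¹) * Real.sqrt (∑ i, ‖f i‖ ^ 2)) := mul_le_mul_of_nonneg_left h2 (by positivity)
    _ = mA⁻¹ * (c₁ * Real.sqrt mB⁻¹ + c₀ * mB⁻¹) * Real.sqrt (∑ i, ‖f i‖ ^ 2) := by ring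

end Summit.QuantumFields.YangMills.Theorems.Prop7InverseDiffFirstOrder

end
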